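import Mathlib

/-!
# SoloBlind — Abel summation over a general block `[a, a+n]` ([O1] Lemma A / Ŝ-summation, PLAN §119.12)

The interval version of `SoloBlindAbelBound`: the inner Volterra sums of `SoloBlindVolterraRepr.volterra_repr` run over
`i ∈ [k, j]`, and the pairing sum `Ŝ` is Abel-summed from `m = 2`; both need the partial-summation identity and bound
on a block starting at an arbitrary index `a`:

  `∑_{i=a}^{a+n} C i (G i - G (i+1)) = C a G a - C (a+n) G (a+n+1) + ∑_{i=a+1}^{a+n} (C i - C (i-1)) G i`,
  `‖·‖ ≤ (‖C a‖ + ‖C (a+n)‖ + ∑_{i=a+1}^{a+n} ‖C i - C (i-1)‖) · M`   whenever `‖G i‖ ≤ M` on `[a, a+n+1]`.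
-/

namespace Summit.AnomalousDissipation.SoloBlind.AbelBoundIco

open Finset

/-- Abel summation identity on the block `[a, a+n]`. -/
theorem abel_identity_block (C G : ℕ → ℂ) (a n : ℕ) :
    ∑ i ∈ Ico a (a + n + 1), C i * (G i - G (i + 1))
      = C a * G a - C (a + n) * G (a + n + 1) + ∑ i ∈ Ico (a + 1) (a + n + 1), (C i - C (i - 1)) * G i := by
  induction n with
  | zero =>
    rw [show a + 0 + 1 = a + 1 from rfl, Finset.Ico_self, sum_empty]
    rw [show Ico a (a + 1) = {a} from by simp]
    simp; ring
  | succ n ih =>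
    rw [show a + (n + 1) + 1 = a + n + 1 + 1 from by omega]
    rw [sum_Ico_succ_top (by omega : a ≤ a + n + 1), ih, sum_Ico_succ_top (by omega : a + 1 ≤ a + n + 1)]
    rw [show a + (n + 1) = a + n + 1 from by omega, show a + n + 1 - 1 = a + n from by omega]
    ring

/-- Abel summation bound on the block `[a, a+n]`. -/
theorem abel_bound_block (C G : ℕ → ℂ) (a n : ℕ) (M : ℝ) (hG : ∀ i, a ≤ i → i ≤ a + n + 1 → ‖G i‖ ≤ M) :
    ‖∑ i ∈ Ico a (a + n + 1), C i * (G i - G (i + 1))‖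
      ≤ (‖C a‖ + ‖C (a + n)‖ + ∑ i ∈ Ico (a + 1) (a + n + 1), ‖C i - C (i - 1)‖) * M := by
  rw [abel_identity_block]
  have h1 : ‖C a * G a‖ ≤ ‖C a‖ * M := by
    rw [norm_mul]; exact mul_le_mul_of_nonneg_left (hG a le_rfl (by omega)) (norm_nonneg _)
  have h2 : ‖C (a + n) * G (a + n + 1)‖ ≤ ‖C (a + n)‖ * M := by
    rw [norm_mul]; exact mul_le_mul_of_nonneg_left (hG (a + n + 1) (by omega) le_rfl) (norm_nonneg _)
  have h3 : ‖∑ i ∈ Ico (a + 1) (a + n + 1), (C i - C (i - 1)) * G i‖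
      ≤ (∑ i ∈ Ico (a + 1) (a + n + 1), ‖C i - C (i - 1)‖) * M := by
    rw [sum_mul]
    refine (norm_sum_le _ _).trans (sum_le_sum (fun i hi => ?_))
    rw [mem_Ico] at hi
    rw [norm_mul]
    exact mul_le_mul_of_nonneg_left (hG i (by omega) (by omega)) (norm_nonneg _)
  calc ‖C a * G a - C (a + n) * G (a + n + 1) + ∑ i ∈ Ico (a + 1) (a + n + 1), (C i - C (i - 1)) * G i‖
      ≤ ‖C a * G a - C (a + n) * G (a + n + 1)‖ + ‖∑ i ∈ Ico (a + 1) (a + n + 1), (C i - C (i - 1)) * G i‖ :=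
        norm_add_le _ _
    _ ≤ (‖C a * G a‖ + ‖C (a + n) * G (a + n + 1)‖) + ‖∑ i ∈ Ico (a + 1) (a + n + 1), (C i - C (i - 1)) * G i‖ := by
        gcongr; exact norm_sub_le _ _
    _ ≤ (‖C a‖ * M + ‖C (a + n)‖ * M) + (∑ i ∈ Ico (a + 1) (a + n + 1), ‖C i - C (i - 1)‖) * M := by gcongr
    _ = (‖C a‖ + ‖C (a + n)‖ + ∑ i ∈ Ico (a + 1) (a + n + 1), ‖C i - C (i - 1)‖) * M := by ring

end Summit.AnomalousDissipation.SoloBlind.AbelBoundIco
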